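import Summits.QuantumFields.YangMills.Theorems.UnitScaleTiltProp8FlatSmallSolution158CubeSeq
import Summits.QuantumFields.YangMills.Theorems.UnitScaleTiltProp8FlatSmallSolution158Real
import Literature.MathematicalPhysics.QuantumFieldTheory.Balaban1983to89.Node00.LargeFieldReprOfRecord
import HarnessLib

/-!
# K0⁷ STUB 1 (`stub_prop8StepCoP13` = [15] Prop. 8 top step ⟺ Sect. F one pass `HalvingStepTop`), sub-target S4a «THE HEART, flat half»:
# **[15] PROPOSITION 6 FOR EQ. (158), THE (165) ENTRY, REALITY AND «Q𝔊 = 0» READ AT NODE 00's RECORD OBJECTS** — the fine torus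
# `PBond (F.P K) 0` of a member `F` of the 𝕋⁴ family (`T4Family`, d = 4), `k` levels, print's level weights `(L^{j(b)}η)^m` with `η = L^{−k} =
# (F.P K).eta k`, on ANY domain sequence `Ω : ℕ → Set (Site (F.P K) 0)` — in particular `s.Ω` of a (2.18) index `s : SeqOfRecord F ν M g K k`

Cell `pub-ymgap`, width seat `pub-ymgap-k0-s1-w1` g0 (director-ym №197 ∕ HUMAN RULING D-0149; plan g77 W-SEAT-START-LIST v3 §k0-s1, w1 ↦ S4a =
dag-n07-e `W-SEAT-START-LIST-N07.md` S4 flat half: «transfer UST `FlatCriticalEquation143` + `FlatSmallSolution158*` to the record's objects»).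
`--kind proof --supports stmt-QuantumFields-20541 --as helper`; count-neutral.  [15] = [Balaban1985Variational] = T. Bałaban, *The variational
problem and background fields in renormalization group method for lattice gauge theories*, Commun. Math. Phys. **102** (1985) 277–309.

WHY.  The K0⁷ skeleton of record (V18) displays stub 1 as dag-n07-e's named fact `Node00.Prop8RegSepTopStep F 2 suppDomOfRecord B₃ a₀ a₁`, kernel-
equivalent (`Node00.halvingStepTop_iff_prop8RegSepTopStep`, module 30) to ONE PASS of [15] Sect. F (144)–(168) at NODE 00's objects.  The heart of that
pass is (157)–(159): in the linearizing chart `A = A′ − HD(A′)` the image of the critical configuration is `A₁ + HB` with `A₁` THE small solution of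
*«A₁ + G̃((δ∕δA′)V)(A₁ + HB) = 0. (158)»* (p. 302), and (165) reads off `|A₁|₍₁₁₅₎ ≤ B₀C₄(36dL²B₁Mε₀)²`.  The route `UnitScaleTilt` (cell ym3-torus) TYPED
AND PROVED Prop. 6 for (158), the (165) entry, the reality of the solution and the «Q𝔊 = 0» clause over ABSTRACT flat-operator data, generically in
`P : Params` (pillar F4 parts 1∕3: `FlatSmallSolution158`, `FlatSmallSolution158Real`) and over arbitrary finite index types with positive LEVEL WEIGHTS
(part 6: `FlatSmallSolution158Levels`), and READ them at its d = 3 carrier (`_T3` twins; part 9 `FlatSmallSolution158CubeSeq` on a domain sequence).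
dag-n07-e's `STUB1-SECTF-MAP.md` lists the row (158)–(159) «at objects: NOTHING».  THIS FILE is the READING AT THE RECORD: the same theorems at the fine
torus of a `T4Family` member with the record's level structure — so that the row now reads «Prop. 6's solution theory for (158) BY NAME at
`PBond (F.P K) 0` with the weights `(L^{j(b)}η_k)^m`, operator letters displayed».  Nothing of UST is restated; every proof is the UST theorem BY NAME.

THE RECORD's LETTERS (dictionary, §0).  Fine lattice = scale `0` of `F.P K` (`T4Family.P`, `(F.P K).d = 4`, `(F.P K).L = F.L` by `rfl`); `k` = the
step of the K0 row (`Prop8RegSepTopStep` binds `K k` and `s : SeqOfRecord F ν M g K k`); print's `η = L^{−k}` IS the record's `(F.P K).eta k`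
(`Params.eta k = (L⁻¹)^k`), and print's level weight `L^jη` of p. 286 ∕ (115) ∕ (152) IS `(F.P K).eta (k − j)` (`levWeightRec_base_eq_eta`); the
difference quotient `∇^η` carries `η⁻¹ = L^k`; the level of a fine bond is lit-balaban's `B11Eq115Space.levOf Ω k b₋` (the largest `j ≤ k` with
`b₋ ∈ Ω j`), exactly as in UST part 9.  Fibre `V` = any finite-dimensional complex normed space (K0: `N = 2`, 𝔤ᶜ = `Matrix (Fin 2) (Fin 2) ℂ`).

WHAT IS PROVED (sorry-free; no definition; axioms standard).
* §0 `levWeightRec_pos`, `levWeightRec_base_eq_eta` (the dictionary `(F.L)^j·((F.L)⁻¹)^k = (F.P K).eta (k − j)` for `j ≤ k`).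
* §1 ONE LEVEL (all `Ω_j = T`, weight `c = L^k`): `existsUnique_smallSolution158_T4` (Prop. 6 for (158)), `size115_solution158_le_T4` ((165)),
  `letter_solution158_le_T4` ((165), any letter), `smallSolution158_valued_T4` (reality), `solution158_mem_ker_T4` («Q𝔊 = 0»).
* §2 MULTI-LEVEL on any `Ω : ℕ → Set (Site (F.P K) 0)` at height `k`: `existsUnique_smallSolution158_recordDom` (Prop. 6 + reality),
  `letter_solution158_recordDom_le` ((165), any letter — the «quadratic in the class radius» shape `N(A₁) ≤ B_N·C₄·ρ²` the S6 assembly consumes),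
  `solution158_recordDom_mem_ker`, and the A6 inhabitant `letters158_recordDom_inhabited_trivial` (the displayed letter block is inhabited at the
  record by the trivial flat instance `G̃ = 0`, `W = 0`, `HB = 0`; the CONTENTFUL inhabitant is S1 + the d = 4 port bridge, not this file).
* §3 the instance at a (2.18) index of record: `existsUnique_smallSolution158_seqOfRecord` (`Ω := s.Ω`; the (165) letter theorem of §2 is weight-free and
  needs no separate instance).

WHAT THIS IS NOT (honest scope).  (i) The operators are HYPOTHESES: `G̃` (the record's `G − HQG` on the cube sequence (144) = S1 + the port bridge at
d = 4), `W = (δ∕δA′)V` with Prop. 4's (98) (S4b, the non-flat half), `𝔄 = HB` with (160)–(161) (S5); Prop. 3's chart (47) is S2 (dag-n07-w2); the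
(159)∕(165)–(167) assembly to `HalvingStepTop` is S6 (dag-n07-w4).  (ii) UST part 5 `FlatCriticalEquation143` ((127) ⟹ (143)) is exact linear algebra over
arbitrary finite index types and needs NO transfer; its inputs at the record are S1's `Δ(1)`, `Q_k`, `R` and dag-n07-e's (27)-pairing
(`Node00.WilsonActionFirstVariationCoDiv`, `…N07CritCurrentForm`).  (iii) Nothing of [15]'s analysis is asserted; `stub_prop8StepCoP13` ∕ K0⁷ NOT closed;
N07 NOT discharged; counts unmoved (28∕28 · 5∕27).  (iv) One finite 𝕋⁴ programme at fixed ε: R4 closes the conditional finite-𝕋⁴ rung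
`BalabanLadder.UV` only, never the summit — the YM mass gap (Clay) is NOT proved by any of this; nothing continuum ∕ ℝ⁴ ∕ OS.  No `sorry`, no `def`,
no `instance`, no `notation`.

References: [15] (115) p.294, Prop. 6 p.295, p.286 (sizes), (144) p.300, (152) p.301, (157)–(159) p.302, (165) p.304; T. Bałaban, CMP **116** (1988)
1–22 [Balaban1988Convergent] (2.18) p.257 (the index `SeqOfRecord`); CMP **109** (1987) 249–301 [Balaban1987RG1] (0.1) p.251 (the tori `T4Family.P`).
-/

set_option autoImplicit false

noncomputable section

open Metric Set

namespace Summit.QuantumFields.YangMills.Theorems.K0Stub1FlatSmallSolution158AtRecord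

open Literature.MathematicalPhysics.QuantumFieldTheory.Balaban1983to89
open Literature.MathematicalPhysics.QuantumFieldTheory.Balaban1983to89.B11Eq115Space (levOf levOf_le)
open Literature.MathematicalPhysics.QuantumFieldTheory.Balaban1983to89.T4Continuum (T4Family)
open Literature.MathematicalPhysics.QuantumFieldTheory.Balaban1983to89.Node00 (Stage7Numerics SeqOfRecord)
open Summit.QuantumFields.YangMills.Theorems.FlatSmallSolution158 (existsUnique_smallSolution158 size115_solution158_le solution158_mem_ker)
open Summit.QuantumFields.YangMills.Theorems.FlatSmallSolution158Real (letter_solution158_le smallSolution158_valued)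
open Summit.QuantumFields.YangMills.Theorems.FlatSmallSolution158Levels (existsUnique_smallSolution158W_valued letter_solution158W_le
  solution158W_mem_ker)

variable {V : Type*} [NormedAddCommGroup V] [NormedSpace ℂ V]

/-! ## §0  The record's letters: `L > 0`, the level weights `(L^{j(b)}η_k)^m` and their reading through `(F.P K).eta` -/

omit [NormedAddCommGroup V] [NormedSpace ℂ V] in
/-- `0 < L` for a member of the 𝕋⁴ family (`L > 11`). [cite: Balaban1987RG1, (0.1) p.251 (bookkeeping)] -/
theorem cast_L_pos (F : T4Family) : (0 : ℝ) < F.L := by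
  exact_mod_cast lt_trans zero_lt_one F.hL.2

omit [NormedAddCommGroup V] [NormedSpace ℂ V] in
/-- **THE LEVEL WEIGHTS OF p. 286 ∕ (115) ∕ (152) AT THE RECORD ARE POSITIVE**: `w m b = (L^{j(b)}·η_k)^m > 0`, `j(b) = levOf Ω k b₋`, `η_k = L^{−k}`.
[cite: Balaban1985Variational, p.286, (152) p.301] -/
theorem levWeightRec_pos (F : T4Family) (K k : ℕ) (Ω : ℕ → Set (Site (F.P K) 0)) (w : ℕ → PBond (F.P K) 0 → ℝ)
    (hw : ∀ m b, w m b = ((F.L : ℝ) ^ levOf Ω k b.src * ((F.L : ℝ)⁻¹) ^ k) ^ m) (m : ℕ) (b : PBond (F.P K) 0) :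
    0 < w m b := by
  have hL := cast_L_pos F
  rw [hw]
  exact pow_pos (mul_pos (pow_pos hL _) (pow_pos (inv_pos.2 hL) _)) m

omit [NormedAddCommGroup V] [NormedSpace ℂ V] in
/-- **DICTIONARY: print's `L^jη` IS the record's `η_{k−j}`** — for `j ≤ k`, `(F.L)^j·((F.L)⁻¹)^k = (F.P K).eta (k − j)` (`Params.eta n = (L⁻¹)^n`,
`(F.P K).L = F.L`).  So the base of the weight `w 1 b` at a fine bond of level `j(b) ≤ k` is the record's spacing letter `(F.P K).eta (k − j(b))`, the
letter in which the K0 row's classes (1.7)∕(1.9) are written (`ε_n·η_n²`, `ε_n·η_n³`). [cite: Balaban1985Variational, p.286; Balaban1987RG1, (0.1) p.251] -/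
theorem levWeightRec_base_eq_eta (F : T4Family) (K k j : ℕ) (hj : j ≤ k) :
    (F.L : ℝ) ^ j * ((F.L : ℝ)⁻¹) ^ k = (F.P K).eta (k - j) := by
  have hL : (F.L : ℝ) ≠ 0 := (cast_L_pos F).ne'
  rw [Params.eta, T4Family.P_L]
  obtain ⟨i, rfl⟩ := Nat.exists_eq_add_of_le hj
  rw [Nat.add_sub_cancel_left, pow_add, ← mul_assoc, ← mul_pow, mul_inv_cancel₀ hL, one_pow, one_mul]

omit [NormedAddCommGroup V] [NormedSpace ℂ V] in
/-- The level-weight base at a fine bond, read through the record's `eta`: `w 1 b = (F.P K).eta (k − levOf Ω k b₋)`.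
[cite: Balaban1985Variational, p.286, (152) p.301] -/
theorem levWeightRec_one_eq_eta (F : T4Family) (K k : ℕ) (Ω : ℕ → Set (Site (F.P K) 0)) (w : ℕ → PBond (F.P K) 0 → ℝ)
    (hw : ∀ m b, w m b = ((F.L : ℝ) ^ levOf Ω k b.src * ((F.L : ℝ)⁻¹) ^ k) ^ m) (b : PBond (F.P K) 0) :
    w 1 b = (F.P K).eta (k - levOf Ω k b.src) := by
  rw [hw, pow_one, levWeightRec_base_eq_eta F K k _ (levOf_le Ω k b.src)]

/-! ## §1  ONE LEVEL at the record's fine torus: [15] Prop. 6 for (158), (165), reality, «Q𝔊 = 0» — weight `c = L^k = η_k⁻¹` -/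

section OneLevel

/-- **[15] PROP. 6 FOR EQ. (158) AT THE RECORD's FINE TORUS, ONE LEVEL** (`PBond (F.P K) 0` of a 𝕋⁴-family member, all `Ω_j = T`, top level `k`,
`η_k⁻¹ = L^k` on the difference quotient; directions `Fin 4 = Fin (F.P K).d`): given `G̃` with the sup → (115) bound `B₀`, `W = (δ∕δA′)V` with Prop. 4's (98) and
holomorphy on the (115)-ball of radius `a₃`, `𝔄 = HB` of (115)-size `< a ≤ ε₄`, and `4ε₄ ≤ a₃`, `16B₀C₄ε₄ ≤ 1` (print: *«we assume that 40dL²B₁Mε₀ ≤ a₄»*):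
EXACTLY ONE `A₁` of (115)-size `≤ ε₄` solves *«A₁ + G̃((δ∕δA′)V)(A₁ + HB) = 0. (158)»*.  UST `FlatSmallSolution158.existsUnique_smallSolution158` at
`P := F.P K`, `c := L^k`; uniform in `F`, `K`, `k`. [cite: Balaban1985Variational, Prop. 6 p.295, (158) p.302] -/
theorem existsUnique_smallSolution158_T4 [FiniteDimensional ℂ V] (F : T4Family) (K k : ℕ)
    (G : (PBond (F.P K) 0 → V) →ₗ[ℂ] (PBond (F.P K) 0 → V)) (W : (PBond (F.P K) 0 → V) → (PBond (F.P K) 0 → V))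
    {B₀ C₄ a₃ a ε₄ : ℝ} (hB₀ : 0 ≤ B₀) (hC₄ : 0 ≤ C₄)
    (hG : ∀ (f : PBond (F.P K) 0 → V) (β : ℝ), (∀ b, ‖f b‖ ≤ β) →
      (∀ b, ‖G f b‖ ≤ B₀ * β) ∧
        ∀ (s : Site (F.P K) 0) (μ ν : Fin 4), (F.L : ℝ) ^ k * ‖G f ⟨s.shift ν, μ⟩ - G f ⟨s, μ⟩‖ ≤ B₀ * β)
    (hWq : ∀ (Y : PBond (F.P K) 0 → V) (r : ℝ), r < a₃ → (∀ b, ‖Y b‖ ≤ r) →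
      (∀ (s : Site (F.P K) 0) (μ ν : Fin 4), (F.L : ℝ) ^ k * ‖Y ⟨s.shift ν, μ⟩ - Y ⟨s, μ⟩‖ ≤ r) →
        ∀ b, ‖W Y b‖ ≤ C₄ * r ^ 2)
    (hWd : DifferentiableOn ℂ W {Y : PBond (F.P K) 0 → V | (∀ b, ‖Y b‖ < a₃) ∧
      ∀ (s : Site (F.P K) 0) (μ ν : Fin 4), (F.L : ℝ) ^ k * ‖Y ⟨s.shift ν, μ⟩ - Y ⟨s, μ⟩‖ < a₃})
    (𝔄 : PBond (F.P K) 0 → V) (h𝔄 : ∀ b, ‖𝔄 b‖ < a)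
    (h𝔄' : ∀ (s : Site (F.P K) 0) (μ ν : Fin 4), (F.L : ℝ) ^ k * ‖𝔄 ⟨s.shift ν, μ⟩ - 𝔄 ⟨s, μ⟩‖ < a)
    (ha : a ≤ ε₄) (hε₄ : 0 ≤ ε₄) (h2 : 4 * ε₄ ≤ a₃) (h3 : 16 * B₀ * C₄ * ε₄ ≤ 1) :
    ∃! A₁ : PBond (F.P K) 0 → V, ((∀ b, ‖A₁ b‖ ≤ ε₄) ∧
      ∀ (s : Site (F.P K) 0) (μ ν : Fin 4), (F.L : ℝ) ^ k * ‖A₁ ⟨s.shift ν, μ⟩ - A₁ ⟨s, μ⟩‖ ≤ ε₄) ∧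
        A₁ + G (W (A₁ + 𝔄)) = 0 :=
  existsUnique_smallSolution158 (P := F.P K) (pow_pos (cast_L_pos F) _) G W hB₀ hC₄ hG hWq hWd 𝔄 h𝔄 h𝔄' ha hε₄ h2 h3

omit [NormedSpace ℂ V] in
/-- **THE (165) ENTRY AT THE RECORD's FINE TORUS, ONE LEVEL**: any solution of (158) with `‖A₁ + HB‖₍₁₁₅₎ ≤ ρ < a₃` (print: `ρ = 36dL²B₁Mε₀`, from (152))
satisfies `|A₁| ≤ B₀C₄ρ²` and `L^k·|A₁(⟨s+e_ν,μ⟩) − A₁(⟨s,μ⟩)| ≤ B₀C₄ρ²` — *«+ B₀C₄(36dL²B₁Mε₀)²»* of (165).  UST `size115_solution158_le` at `P := F.P K`.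
[cite: Balaban1985Variational, (165) p.304, (158) p.302] -/
theorem size115_solution158_le_T4 [NormedSpace ℂ V] (F : T4Family) (K k : ℕ)
    (G : (PBond (F.P K) 0 → V) →ₗ[ℂ] (PBond (F.P K) 0 → V)) (W : (PBond (F.P K) 0 → V) → (PBond (F.P K) 0 → V))
    {B₀ C₄ a₃ ρ : ℝ}
    (hG : ∀ (f : PBond (F.P K) 0 → V) (β : ℝ), (∀ b, ‖f b‖ ≤ β) →
      (∀ b, ‖G f b‖ ≤ B₀ * β) ∧
        ∀ (s : Site (F.P K) 0) (μ ν : Fin 4), (F.L : ℝ) ^ k * ‖G f ⟨s.shift ν, μ⟩ - G f ⟨s, μ⟩‖ ≤ B₀ * β)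
    (hWq : ∀ (Y : PBond (F.P K) 0 → V) (r : ℝ), r < a₃ → (∀ b, ‖Y b‖ ≤ r) →
      (∀ (s : Site (F.P K) 0) (μ ν : Fin 4), (F.L : ℝ) ^ k * ‖Y ⟨s.shift ν, μ⟩ - Y ⟨s, μ⟩‖ ≤ r) →
        ∀ b, ‖W Y b‖ ≤ C₄ * r ^ 2)
    {A₁ 𝔄 : PBond (F.P K) 0 → V} (hsol : A₁ + G (W (A₁ + 𝔄)) = 0) (hρ : ρ < a₃)
    (h1 : ∀ b, ‖(A₁ + 𝔄) b‖ ≤ ρ)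
    (h2 : ∀ (s : Site (F.P K) 0) (μ ν : Fin 4), (F.L : ℝ) ^ k * ‖(A₁ + 𝔄) ⟨s.shift ν, μ⟩ - (A₁ + 𝔄) ⟨s, μ⟩‖ ≤ ρ) :
    (∀ b, ‖A₁ b‖ ≤ B₀ * C₄ * ρ ^ 2) ∧
      ∀ (s : Site (F.P K) 0) (μ ν : Fin 4), (F.L : ℝ) ^ k * ‖A₁ ⟨s.shift ν, μ⟩ - A₁ ⟨s, μ⟩‖ ≤ B₀ * C₄ * ρ ^ 2 :=
  size115_solution158_le (P := F.P K) G W hG hWq hsol hρ h1 h2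

omit [NormedSpace ℂ V] in
/-- **THE (165) ENTRY FOR AN ARBITRARY LETTER AT THE RECORD's FINE TORUS, ONE LEVEL**: `N(−G̃f) ≤ B_N·β` for `|f| ≤ β` and Prop. 4's (98) pointwise give
`N(A₁) ≤ B_N·C₄ρ²` for every solution of (158) with `‖A₁ + HB‖₍₁₁₅₎ ≤ ρ < a₃` — any of the four sizes of (165) (`|A₁|`, `|∇A₁|`, `|∂*∂A₁|`, `|ΔA₁|`).
UST `FlatSmallSolution158Real.letter_solution158_le` at `P := F.P K`. [cite: Balaban1985Variational, (165) p.304] -/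
theorem letter_solution158_le_T4 [NormedSpace ℂ V] (F : T4Family) (K k : ℕ)
    (G : (PBond (F.P K) 0 → V) →ₗ[ℂ] (PBond (F.P K) 0 → V)) (W : (PBond (F.P K) 0 → V) → (PBond (F.P K) 0 → V))
    {C₄ a₃ ρ : ℝ}
    (hWq : ∀ (Y : PBond (F.P K) 0 → V) (r : ℝ), r < a₃ → (∀ b, ‖Y b‖ ≤ r) →
      (∀ (s : Site (F.P K) 0) (μ ν : Fin 4), (F.L : ℝ) ^ k * ‖Y ⟨s.shift ν, μ⟩ - Y ⟨s, μ⟩‖ ≤ r) →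
        ∀ b, ‖W Y b‖ ≤ C₄ * r ^ 2)
    {A₁ 𝔄 : PBond (F.P K) 0 → V} (hsol : A₁ + G (W (A₁ + 𝔄)) = 0) (hρ : ρ < a₃)
    (h1 : ∀ b, ‖(A₁ + 𝔄) b‖ ≤ ρ)
    (h2 : ∀ (s : Site (F.P K) 0) (μ ν : Fin 4), (F.L : ℝ) ^ k * ‖(A₁ + 𝔄) ⟨s.shift ν, μ⟩ - (A₁ + 𝔄) ⟨s, μ⟩‖ ≤ ρ)
    (N : (PBond (F.P K) 0 → V) → ℝ) {B : ℝ}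
    (hN : ∀ (f : PBond (F.P K) 0 → V) (β : ℝ), (∀ b, ‖f b‖ ≤ β) → N (-(G f)) ≤ B * β) :
    N A₁ ≤ B * (C₄ * ρ ^ 2) :=
  letter_solution158_le (P := F.P K) G W hWq hsol hρ h1 h2 N hN

/-- **REALITY OF THE SMALL SOLUTION OF (158) AT THE RECORD's FINE TORUS, ONE LEVEL**: with the data of `existsUnique_smallSolution158_T4` and a closed value
set `S ⊆ V` containing `0` (print: `S = 𝔤 = su(2) ⊂ 𝔤ᶜ`) preserved by `X ↦ −G̃(W(X + HB))` on `S`-valued fields of (115)-size `≤ ε₄`, every solution of (158)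
of (115)-size `≤ ε₄` — in particular the unique one — is `S`-valued.  UST `FlatSmallSolution158Real.smallSolution158_valued` at `P := F.P K`.
[cite: Balaban1985Variational, Prop. 6 pp.295–296, (158) p.302] -/
theorem smallSolution158_valued_T4 [FiniteDimensional ℂ V] (F : T4Family) (K k : ℕ)
    (G : (PBond (F.P K) 0 → V) →ₗ[ℂ] (PBond (F.P K) 0 → V)) (W : (PBond (F.P K) 0 → V) → (PBond (F.P K) 0 → V))
    {B₀ C₄ a₃ a ε₄ : ℝ} (hB₀ : 0 ≤ B₀) (hC₄ : 0 ≤ C₄)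
    (hG : ∀ (f : PBond (F.P K) 0 → V) (β : ℝ), (∀ b, ‖f b‖ ≤ β) →
      (∀ b, ‖G f b‖ ≤ B₀ * β) ∧
        ∀ (s : Site (F.P K) 0) (μ ν : Fin 4), (F.L : ℝ) ^ k * ‖G f ⟨s.shift ν, μ⟩ - G f ⟨s, μ⟩‖ ≤ B₀ * β)
    (hWq : ∀ (Y : PBond (F.P K) 0 → V) (r : ℝ), r < a₃ → (∀ b, ‖Y b‖ ≤ r) →
      (∀ (s : Site (F.P K) 0) (μ ν : Fin 4), (F.L : ℝ) ^ k * ‖Y ⟨s.shift ν, μ⟩ - Y ⟨s, μ⟩‖ ≤ r) →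
        ∀ b, ‖W Y b‖ ≤ C₄ * r ^ 2)
    (hWd : DifferentiableOn ℂ W {Y : PBond (F.P K) 0 → V | (∀ b, ‖Y b‖ < a₃) ∧
      ∀ (s : Site (F.P K) 0) (μ ν : Fin 4), (F.L : ℝ) ^ k * ‖Y ⟨s.shift ν, μ⟩ - Y ⟨s, μ⟩‖ < a₃})
    (𝔄 : PBond (F.P K) 0 → V) (h𝔄 : ∀ b, ‖𝔄 b‖ < a)
    (h𝔄' : ∀ (s : Site (F.P K) 0) (μ ν : Fin 4), (F.L : ℝ) ^ k * ‖𝔄 ⟨s.shift ν, μ⟩ - 𝔄 ⟨s, μ⟩‖ < a)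
    (ha : a ≤ ε₄) (hε₄ : 0 ≤ ε₄) (h2 : 4 * ε₄ ≤ a₃) (h3 : 16 * B₀ * C₄ * ε₄ ≤ 1)
    (S : Set V) (hS : IsClosed S) (h0 : (0 : V) ∈ S)
    (hinv : ∀ X : PBond (F.P K) 0 → V, (∀ b, X b ∈ S) → (∀ b, ‖X b‖ ≤ ε₄) →
      (∀ (s : Site (F.P K) 0) (μ ν : Fin 4), (F.L : ℝ) ^ k * ‖X ⟨s.shift ν, μ⟩ - X ⟨s, μ⟩‖ ≤ ε₄) →
        ∀ b, -(G (W (X + 𝔄)) b) ∈ S)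
    {A₁ : PBond (F.P K) 0 → V}
    (hA₁ : (∀ b, ‖A₁ b‖ ≤ ε₄) ∧
      ∀ (s : Site (F.P K) 0) (μ ν : Fin 4), (F.L : ℝ) ^ k * ‖A₁ ⟨s.shift ν, μ⟩ - A₁ ⟨s, μ⟩‖ ≤ ε₄)
    (hsol : A₁ + G (W (A₁ + 𝔄)) = 0) : ∀ b, A₁ b ∈ S :=
  smallSolution158_valued (P := F.P K) (pow_pos (cast_L_pos F) _) G W hB₀ hC₄ hG hWq hWd 𝔄 h𝔄 h𝔄' ha hε₄ h2 h3 S hS h0 hinv hA₁ hsol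

omit [NormedSpace ℂ V] in
/-- **«Q𝔊 = 0 ⇒ QA₁ = 0» AT THE RECORD's FINE TORUS** (p. 294): every additive `Q` on the fine fields with `Q ∘ G̃ = 0` — at the record: the linearisation of
the `k`-fold (0.4) descent `avOfRecord F 2 K` (= `blockAvg expMeanLogSU`, `Node00.avOfRecord_apply`) in the chart, or the residual Landau gauge — annihilates
every solution of (158).  UST `FlatSmallSolution158.solution158_mem_ker` at `P := F.P K`. [cite: Balaban1985Variational, (108)–(111) p.294, (158) p.302] -/
theorem solution158_mem_ker_T4 [NormedSpace ℂ V] (F : T4Family) (K : ℕ) {X : Type*} [AddCommGroup X]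
    (Q : (PBond (F.P K) 0 → V) →+ X) (G : (PBond (F.P K) 0 → V) →ₗ[ℂ] (PBond (F.P K) 0 → V))
    (W : (PBond (F.P K) 0 → V) → (PBond (F.P K) 0 → V)) (hQ : ∀ f, Q (G f) = 0)
    {A₁ 𝔄 : PBond (F.P K) 0 → V} (hsol : A₁ + G (W (A₁ + 𝔄)) = 0) : Q A₁ = 0 :=
  solution158_mem_ker (P := F.P K) Q G W hQ hsol

end OneLevel

/-! ## §2  MULTI-LEVEL at the record: any domain sequence `Ω : ℕ → Set (Site (F.P K) 0)` at height `k`, weights `(L^{j(b)}η_k)^m` -/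

section MultiLevel

/-- **[15] PROP. 6 FOR (158) ON A DOMAIN SEQUENCE AT THE RECORD's FINE TORUS, LEVEL-WEIGHTED (152)-SIZES, WITH REALITY** (weights
`w m b = (L^{j(b)}η_k)^m`, `j(b) = levOf Ω k b₋`, `η_k = L^{−k} = (F.P K).eta k`; gradient factor `η_k⁻¹ = L^k`; directions `Fin 4`): for `G̃` with «current
size `f` ≤ β ⇒ size `G̃f` ≤ B₀β» (the record's `G − HQG` on the cube sequence (144): S1 + the d = 4 port bridge), `W` with Prop. 4's (98) pointwise and holomorphy
on the size-ball of radius `a₃` (S4b), `𝔄 = HB` of size `< a` (S5), `0 < a ≤ ε₄`, `4ε₄ ≤ a₃`, `16B₀C₄ε₄ ≤ 1`: EXACTLY ONE `A₁` of size `≤ ε₄` solves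
*«A₁ + G̃((δ∕δA′)V)(A₁ + HB) = 0. (158)»*, and every such solution is `S`-valued for every closed value set `S ∋ 0` preserved by `X ↦ −G̃(W(X + HB))`
(reality: `S = su(2)`).  UST `FlatSmallSolution158Levels.existsUnique_smallSolution158W_valued` at `ι := PBond (F.P K) 0`, `κ := ι × Fin 4`, the displayed
weights.  `Ω` is ANY sequence: `s.Ω` of a (2.18) index (§3), the cube sequence (144) of Sect. F once S1∕S3 name it at the record.
[cite: Balaban1985Variational, Prop. 6 p.295, (152) p.301, (158) p.302] -/
theorem existsUnique_smallSolution158_recordDom [FiniteDimensional ℂ V] (F : T4Family) (K k : ℕ) (Ω : ℕ → Set (Site (F.P K) 0))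
    (w : ℕ → PBond (F.P K) 0 → ℝ) (hw : ∀ m b, w m b = ((F.L : ℝ) ^ levOf Ω k b.src * ((F.L : ℝ)⁻¹) ^ k) ^ m)
    (G : (PBond (F.P K) 0 → V) →ₗ[ℂ] (PBond (F.P K) 0 → V)) (W : (PBond (F.P K) 0 → V) → (PBond (F.P K) 0 → V))
    {B₀ C₄ a₃ a ε₄ : ℝ} (hB₀ : 0 ≤ B₀) (hC₄ : 0 ≤ C₄)
    (hG : ∀ (f : PBond (F.P K) 0 → V) (β : ℝ), (∀ b, w 3 b * ‖f b‖ ≤ β) →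
      (∀ b, w 1 b * ‖G f b‖ ≤ B₀ * β) ∧
        ∀ (b : PBond (F.P K) 0) (ν : Fin 4), w 2 b * (F.L : ℝ) ^ k * ‖G f ⟨b.src.shift ν, b.dir⟩ - G f b‖ ≤ B₀ * β)
    (hWq : ∀ (Y : PBond (F.P K) 0 → V) (r : ℝ), r < a₃ → (∀ b, w 1 b * ‖Y b‖ ≤ r) →
      (∀ (b : PBond (F.P K) 0) (ν : Fin 4), w 2 b * (F.L : ℝ) ^ k * ‖Y ⟨b.src.shift ν, b.dir⟩ - Y b‖ ≤ r) →
        ∀ b, w 3 b * ‖W Y b‖ ≤ C₄ * r ^ 2)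
    (hWd : DifferentiableOn ℂ W {Y : PBond (F.P K) 0 → V | (∀ b, w 1 b * ‖Y b‖ < a₃) ∧
      ∀ (b : PBond (F.P K) 0) (ν : Fin 4), w 2 b * (F.L : ℝ) ^ k * ‖Y ⟨b.src.shift ν, b.dir⟩ - Y b‖ < a₃})
    (𝔄 : PBond (F.P K) 0 → V) (ha0 : 0 < a) (h𝔄 : ∀ b, w 1 b * ‖𝔄 b‖ < a)
    (h𝔄' : ∀ (b : PBond (F.P K) 0) (ν : Fin 4), w 2 b * (F.L : ℝ) ^ k * ‖𝔄 ⟨b.src.shift ν, b.dir⟩ - 𝔄 b‖ < a)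
    (ha : a ≤ ε₄) (hε₄ : 0 ≤ ε₄) (h2 : 4 * ε₄ ≤ a₃) (h3 : 16 * B₀ * C₄ * ε₄ ≤ 1) :
    (∃! A₁ : PBond (F.P K) 0 → V, ((∀ b, w 1 b * ‖A₁ b‖ ≤ ε₄) ∧
        ∀ (b : PBond (F.P K) 0) (ν : Fin 4), w 2 b * (F.L : ℝ) ^ k * ‖A₁ ⟨b.src.shift ν, b.dir⟩ - A₁ b‖ ≤ ε₄) ∧
      A₁ + G (W (A₁ + 𝔄)) = 0) ∧
    ∀ (S : Set V), IsClosed S → (0 : V) ∈ S →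
      (∀ X : PBond (F.P K) 0 → V, (∀ b, X b ∈ S) → (∀ b, w 1 b * ‖X b‖ ≤ ε₄) →
        (∀ (b : PBond (F.P K) 0) (ν : Fin 4), w 2 b * (F.L : ℝ) ^ k * ‖X ⟨b.src.shift ν, b.dir⟩ - X b‖ ≤ ε₄) →
          ∀ b, -(G (W (X + 𝔄)) b) ∈ S) →
      ∀ A₁ : PBond (F.P K) 0 → V, ((∀ b, w 1 b * ‖A₁ b‖ ≤ ε₄) ∧
          ∀ (b : PBond (F.P K) 0) (ν : Fin 4), w 2 b * (F.L : ℝ) ^ k * ‖A₁ ⟨b.src.shift ν, b.dir⟩ - A₁ b‖ ≤ ε₄) →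
        A₁ + G (W (A₁ + 𝔄)) = 0 → ∀ b, A₁ b ∈ S := by
  have hL := cast_L_pos F
  have hpos := levWeightRec_pos F K k Ω w hw
  -- pair structure κ = bond × direction, weights w 1, (w 2)·L^k, w 3
  have h := existsUnique_smallSolution158W_valued (ι := PBond (F.P K) 0) (κ := PBond (F.P K) 0 × Fin 4) (V := V)
    (fun p => p.1) (fun p => (⟨p.1.src.shift p.2, p.1.dir⟩ : PBond (F.P K) 0))
    (w₀ := w 1) (w₃ := w 3) (w₁ := fun p => w 2 p.1 * (F.L : ℝ) ^ k)
    (hpos 1) (fun p => mul_pos (hpos 2 p.1) (pow_pos hL _)) (hpos 3) G W hB₀ hC₄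
    (fun f β hf => ⟨(hG f β hf).1, fun p => (hG f β hf).2 p.1 p.2⟩)
    (fun Y r hr h1 h2 => hWq Y r hr h1 (fun b ν => h2 (b, ν)))
    (by
      have e : {Y : PBond (F.P K) 0 → V | (∀ b, w 1 b * ‖Y b‖ < a₃) ∧
          ∀ p : PBond (F.P K) 0 × Fin 4, w 2 p.1 * (F.L : ℝ) ^ k * ‖Y ⟨p.1.src.shift p.2, p.1.dir⟩ - Y p.1‖ < a₃} =
          {Y : PBond (F.P K) 0 → V | (∀ b, w 1 b * ‖Y b‖ < a₃) ∧
          ∀ (b : PBond (F.P K) 0) (ν : Fin 4), w 2 b * (F.L : ℝ) ^ k * ‖Y ⟨b.src.shift ν, b.dir⟩ - Y b‖ < a₃} := by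
        ext Y; simp only [Set.mem_setOf_eq, Prod.forall]
      rw [e]; exact hWd)
    𝔄 ha0 h𝔄 (fun p => h𝔄' p.1 p.2) ha hε₄ h2 h3
  refine ⟨?_, fun S hS h0 hinv A₁ hA₁ hsol b => ?_⟩
  · obtain ⟨A₁, ⟨hsz, hsol⟩, huniq⟩ := h.1
    refine ⟨A₁, ⟨⟨hsz.1, fun b ν => hsz.2 (b, ν)⟩, hsol⟩, fun A₁' hA₁' => huniq A₁' ⟨⟨hA₁'.1.1, fun p => hA₁'.1.2 p.1 p.2⟩, hA₁'.2⟩⟩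
  · exact h.2 S hS h0 (fun X hX h1 h2 => hinv X hX h1 (fun b' ν => h2 (b', ν))) A₁ ⟨hA₁.1, fun p => hA₁.2 p.1 p.2⟩ hsol b

omit [NormedSpace ℂ V] in
/-- **THE (165) ENTRY ON A DOMAIN SEQUENCE AT THE RECORD, LEVEL-WEIGHTED, ANY LETTER**: `N(−G̃f) ≤ B_N·β` under «current size `f` ≤ β» and Prop. 4's
(98) give `N(A₁) ≤ B_N·C₄ρ²` for every solution of (158) with size(`A₁ + 𝔄`) `≤ ρ < a₃` (print `ρ = 36dL²B₁Mε₀`; the four sizes of (165) = four letters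
`N`) — the «quadratic in the class radius» term of the per-plaquette budget (165) that the S6 assembly (`Node00.HalvingStepTop` via modules 31∕33c) consumes.
No smallness, no uniqueness, ANY weights `w`.  UST `FlatSmallSolution158Levels.letter_solution158W_le`. [cite: Balaban1985Variational, (165) p.304, (152) p.301] -/
theorem letter_solution158_recordDom_le [NormedSpace ℂ V] (F : T4Family) (K k : ℕ) (w : ℕ → PBond (F.P K) 0 → ℝ)
    (G : (PBond (F.P K) 0 → V) →ₗ[ℂ] (PBond (F.P K) 0 → V)) (W : (PBond (F.P K) 0 → V) → (PBond (F.P K) 0 → V))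
    {C₄ a₃ ρ : ℝ}
    (hWq : ∀ (Y : PBond (F.P K) 0 → V) (r : ℝ), r < a₃ → (∀ b, w 1 b * ‖Y b‖ ≤ r) →
      (∀ (b : PBond (F.P K) 0) (ν : Fin 4), w 2 b * (F.L : ℝ) ^ k * ‖Y ⟨b.src.shift ν, b.dir⟩ - Y b‖ ≤ r) →
        ∀ b, w 3 b * ‖W Y b‖ ≤ C₄ * r ^ 2)
    {A₁ 𝔄 : PBond (F.P K) 0 → V} (hsol : A₁ + G (W (A₁ + 𝔄)) = 0) (hρ : ρ < a₃)
    (h1 : ∀ b, w 1 b * ‖(A₁ + 𝔄) b‖ ≤ ρ)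
    (h2 : ∀ (b : PBond (F.P K) 0) (ν : Fin 4), w 2 b * (F.L : ℝ) ^ k * ‖(A₁ + 𝔄) ⟨b.src.shift ν, b.dir⟩ - (A₁ + 𝔄) b‖ ≤ ρ)
    (N : (PBond (F.P K) 0 → V) → ℝ) {B : ℝ}
    (hN : ∀ (f : PBond (F.P K) 0 → V) (β : ℝ), (∀ b, w 3 b * ‖f b‖ ≤ β) → N (-(G f)) ≤ B * β) :
    N A₁ ≤ B * (C₄ * ρ ^ 2) :=
  letter_solution158W_le (ι := PBond (F.P K) 0) (κ := PBond (F.P K) 0 × Fin 4) (fun p => p.1)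
    (fun p => (⟨p.1.src.shift p.2, p.1.dir⟩ : PBond (F.P K) 0)) (w₀ := w 1) (w₃ := w 3)
    (w₁ := fun p => w 2 p.1 * (F.L : ℝ) ^ k) G W
    (fun Y r hr ha hb => hWq Y r hr ha (fun b ν => hb (b, ν))) hsol hρ h1 (fun p => h2 p.1 p.2) N hN

omit [NormedSpace ℂ V] in
/-- **«Q𝔊 = 0 ⇒ QA₁ = 0» ON A DOMAIN SEQUENCE AT THE RECORD** for every additive `Q` on the fine fields with `Q ∘ G̃ = 0` — at the record: the multi-level
linearised (0.4)-constraints (156)–(157) of `avOfRecord F 2 K` on the index set of `Ω` (S1∕S2), or the Landau condition (153).  UST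
`FlatSmallSolution158Levels.solution158W_mem_ker`. [cite: Balaban1985Variational, (156)–(158) p.302, (108)–(111) p.294] -/
theorem solution158_recordDom_mem_ker [NormedSpace ℂ V] (F : T4Family) (K : ℕ) {X : Type*} [AddCommGroup X]
    (Q : (PBond (F.P K) 0 → V) →+ X) (G : (PBond (F.P K) 0 → V) →ₗ[ℂ] (PBond (F.P K) 0 → V))
    (W : (PBond (F.P K) 0 → V) → (PBond (F.P K) 0 → V)) (hQ : ∀ f, Q (G f) = 0)
    {A₁ 𝔄 : PBond (F.P K) 0 → V} (hsol : A₁ + G (W (A₁ + 𝔄)) = 0) : Q A₁ = 0 :=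
  solution158W_mem_ker (ι := PBond (F.P K) 0) Q G W hQ hsol

/-- **A6 — THE DISPLAYED LETTER BLOCK OF `existsUnique_smallSolution158_recordDom` IS INHABITED AT THE RECORD** (for every member, `K`, `k`, `Ω`, and the
record's weights): the TRIVIAL flat instance `G̃ := 0`, `W := 0`, `HB := 0`, `B₀ = C₄ = 0`, `a = ε₄ = 1`, `a₃ = 4` meets `hG`, `hWq`, `hWd`, `h𝔄`, `h𝔄'` and
the threshold clauses.  This only certifies that the hypotheses are jointly satisfiable (no uninhabited antecedent); the CONTENTFUL inhabitant — the record's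
`G − HQG` with the port-bridge letters, the true `(δ∕δA′)V`, the true `HB` — is S1∕S4b∕S5's, not this file's. [cite: Balaban1985Variational, (158) p.302 (bookkeeping)] -/
theorem letters158_recordDom_inhabited_trivial (F : T4Family) (K k : ℕ) (Ω : ℕ → Set (Site (F.P K) 0))
    (w : ℕ → PBond (F.P K) 0 → ℝ) (hw : ∀ m b, w m b = ((F.L : ℝ) ^ levOf Ω k b.src * ((F.L : ℝ)⁻¹) ^ k) ^ m) :
    ∃ (G : (PBond (F.P K) 0 → V) →ₗ[ℂ] (PBond (F.P K) 0 → V)) (W : (PBond (F.P K) 0 → V) → (PBond (F.P K) 0 → V))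
      (𝔄 : PBond (F.P K) 0 → V) (B₀ C₄ a₃ a ε₄ : ℝ),
      0 ≤ B₀ ∧ 0 ≤ C₄ ∧
      (∀ (f : PBond (F.P K) 0 → V) (β : ℝ), (∀ b, w 3 b * ‖f b‖ ≤ β) →
        (∀ b, w 1 b * ‖G f b‖ ≤ B₀ * β) ∧
          ∀ (b : PBond (F.P K) 0) (ν : Fin 4), w 2 b * (F.L : ℝ) ^ k * ‖G f ⟨b.src.shift ν, b.dir⟩ - G f b‖ ≤ B₀ * β) ∧
      (∀ (Y : PBond (F.P K) 0 → V) (r : ℝ), r < a₃ → (∀ b, w 1 b * ‖Y b‖ ≤ r) →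
        (∀ (b : PBond (F.P K) 0) (ν : Fin 4), w 2 b * (F.L : ℝ) ^ k * ‖Y ⟨b.src.shift ν, b.dir⟩ - Y b‖ ≤ r) →
          ∀ b, w 3 b * ‖W Y b‖ ≤ C₄ * r ^ 2) ∧
      DifferentiableOn ℂ W {Y : PBond (F.P K) 0 → V | (∀ b, w 1 b * ‖Y b‖ < a₃) ∧
        ∀ (b : PBond (F.P K) 0) (ν : Fin 4), w 2 b * (F.L : ℝ) ^ k * ‖Y ⟨b.src.shift ν, b.dir⟩ - Y b‖ < a₃} ∧
      0 < a ∧ (∀ b, w 1 b * ‖𝔄 b‖ < a) ∧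
      (∀ (b : PBond (F.P K) 0) (ν : Fin 4), w 2 b * (F.L : ℝ) ^ k * ‖𝔄 ⟨b.src.shift ν, b.dir⟩ - 𝔄 b‖ < a) ∧
      a ≤ ε₄ ∧ 0 ≤ ε₄ ∧ 4 * ε₄ ≤ a₃ ∧ 16 * B₀ * C₄ * ε₄ ≤ 1 := by
  have hpos := levWeightRec_pos F K k Ω w hw
  refine ⟨0, fun _ => 0, 0, 0, 0, 4, 1, 1, le_rfl, le_rfl, ?_, ?_, ?_, one_pos, ?_, ?_, le_rfl, zero_le_one, by norm_num, by norm_num⟩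
  · intro f β hf
    have hβ : 0 ≤ β := by
      obtain ⟨b⟩ : Nonempty (PBond (F.P K) 0) := ⟨⟨default, ⟨0, (F.P K).hd⟩⟩⟩
      exact (mul_nonneg (hpos 3 b).le (norm_nonneg _)).trans (hf b)
    refine ⟨fun b => ?_, fun b ν => ?_⟩
    · simp only [LinearMap.zero_apply, Pi.zero_apply, norm_zero, mul_zero, zero_mul, le_refl]
    · simp only [LinearMap.zero_apply, Pi.zero_apply, sub_self, norm_zero, mul_zero, zero_mul, le_refl]
  · intro Y r _ _ _ b
    simp only [Pi.zero_apply, norm_zero, mul_zero, zero_mul, le_refl]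
  · exact differentiableOn_const _
  · intro b; simp only [Pi.zero_apply, norm_zero, mul_zero, zero_lt_one]
  · intro b ν; simp only [Pi.zero_apply, sub_self, norm_zero, mul_zero, zero_lt_one]

end MultiLevel

/-! ## §3  The instance at a (2.18) index of record `s : SeqOfRecord F ν M g K k` (`Ω := s.Ω`) -/

section AtSeqOfRecord

/-- **[15] PROP. 6 FOR (158) ON THE DOMAIN SEQUENCE `s.Ω` OF A (2.18) INDEX OF RECORD** (`s : SeqOfRecord F ν M g K k`, the index the K0 row's
`Prop8RegSepTopStep` ∕ `HalvingStepTop` bind; level weights `(L^{j(b)}η_k)^m`, `j(b) = levOf s.Ω k b₋`): existence, uniqueness and `S`-valuedness of the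
small solution of (158), operator letters displayed — `existsUnique_smallSolution158_recordDom` at `Ω := s.Ω`.
[cite: Balaban1985Variational, Prop. 6 p.295, (158) p.302; Balaban1988Convergent, (2.18) p.257] -/
theorem existsUnique_smallSolution158_seqOfRecord [FiniteDimensional ℂ V] (F : T4Family) (ν : Stage7Numerics) (M : ℕ) (g : ℕ → ℝ)
    (K k : ℕ) (s : SeqOfRecord F ν M g K k)
    (w : ℕ → PBond (F.P K) 0 → ℝ) (hw : ∀ m b, w m b = ((F.L : ℝ) ^ levOf s.Ω k b.src * ((F.L : ℝ)⁻¹) ^ k) ^ m)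
    (G : (PBond (F.P K) 0 → V) →ₗ[ℂ] (PBond (F.P K) 0 → V)) (W : (PBond (F.P K) 0 → V) → (PBond (F.P K) 0 → V))
    {B₀ C₄ a₃ a ε₄ : ℝ} (hB₀ : 0 ≤ B₀) (hC₄ : 0 ≤ C₄)
    (hG : ∀ (f : PBond (F.P K) 0 → V) (β : ℝ), (∀ b, w 3 b * ‖f b‖ ≤ β) →
      (∀ b, w 1 b * ‖G f b‖ ≤ B₀ * β) ∧
        ∀ (b : PBond (F.P K) 0) (ν' : Fin 4), w 2 b * (F.L : ℝ) ^ k * ‖G f ⟨b.src.shift ν', b.dir⟩ - G f b‖ ≤ B₀ * β)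
    (hWq : ∀ (Y : PBond (F.P K) 0 → V) (r : ℝ), r < a₃ → (∀ b, w 1 b * ‖Y b‖ ≤ r) →
      (∀ (b : PBond (F.P K) 0) (ν' : Fin 4), w 2 b * (F.L : ℝ) ^ k * ‖Y ⟨b.src.shift ν', b.dir⟩ - Y b‖ ≤ r) →
        ∀ b, w 3 b * ‖W Y b‖ ≤ C₄ * r ^ 2)
    (hWd : DifferentiableOn ℂ W {Y : PBond (F.P K) 0 → V | (∀ b, w 1 b * ‖Y b‖ < a₃) ∧
      ∀ (b : PBond (F.P K) 0) (ν' : Fin 4), w 2 b * (F.L : ℝ) ^ k * ‖Y ⟨b.src.shift ν', b.dir⟩ - Y b‖ < a₃})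
    (𝔄 : PBond (F.P K) 0 → V) (ha0 : 0 < a) (h𝔄 : ∀ b, w 1 b * ‖𝔄 b‖ < a)
    (h𝔄' : ∀ (b : PBond (F.P K) 0) (ν' : Fin 4), w 2 b * (F.L : ℝ) ^ k * ‖𝔄 ⟨b.src.shift ν', b.dir⟩ - 𝔄 b‖ < a)
    (ha : a ≤ ε₄) (hε₄ : 0 ≤ ε₄) (h2 : 4 * ε₄ ≤ a₃) (h3 : 16 * B₀ * C₄ * ε₄ ≤ 1) :
    (∃! A₁ : PBond (F.P K) 0 → V, ((∀ b, w 1 b * ‖A₁ b‖ ≤ ε₄) ∧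
        ∀ (b : PBond (F.P K) 0) (ν' : Fin 4), w 2 b * (F.L : ℝ) ^ k * ‖A₁ ⟨b.src.shift ν', b.dir⟩ - A₁ b‖ ≤ ε₄) ∧
      A₁ + G (W (A₁ + 𝔄)) = 0) ∧
    ∀ (S : Set V), IsClosed S → (0 : V) ∈ S →
      (∀ X : PBond (F.P K) 0 → V, (∀ b, X b ∈ S) → (∀ b, w 1 b * ‖X b‖ ≤ ε₄) →
        (∀ (b : PBond (F.P K) 0) (ν' : Fin 4), w 2 b * (F.L : ℝ) ^ k * ‖X ⟨b.src.shift ν', b.dir⟩ - X b‖ ≤ ε₄) →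
          ∀ b, -(G (W (X + 𝔄)) b) ∈ S) →
      ∀ A₁ : PBond (F.P K) 0 → V, ((∀ b, w 1 b * ‖A₁ b‖ ≤ ε₄) ∧
          ∀ (b : PBond (F.P K) 0) (ν' : Fin 4), w 2 b * (F.L : ℝ) ^ k * ‖A₁ ⟨b.src.shift ν', b.dir⟩ - A₁ b‖ ≤ ε₄) →
        A₁ + G (W (A₁ + 𝔄)) = 0 → ∀ b, A₁ b ∈ S :=
  existsUnique_smallSolution158_recordDom F K k s.Ω w hw G W hB₀ hC₄ hG hWq hWd 𝔄 ha0 h𝔄 h𝔄' ha hε₄ h2 h3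

end AtSeqOfRecord

end Summit.QuantumFields.YangMills.Theorems.K0Stub1FlatSmallSolution158AtRecord

end
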